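import Literature.Analysis.ODE.VariationOfParametersIoi
import Literature.Analysis.ODE.ComplexSecondOrder
import HarnessLib

/-!
# The outgoing Jost representation `u = A e^{iωx} + e` of an infinity-normalised solution of
# `u″ + (ω² − V)u = 0` at real energy, with the QUANTITATIVE remainder `‖e(x)‖ ≤ (B/|ω|) ∫ₓ^∞ |V|`

Topic `Literature/Analysis/ODE` (namespace `Literature.Analysis.ODE`). Let `ω ≠ 0` be real, `V` real
and continuous, and let `u` be a global classical solution of `u″ + (ω² − V(x)) u = 0` (the format of
the tree's Carter/Teukolsky files: `HasDerivAt u (u₁ x) x ∧ HasDerivAt u₁ (−(ω² − V x)·u x) x`).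
Suppose that on a right half-line `(X, ∞)` the potential is integrable and `‖u‖ ≤ B`, and that `u`
carries the data of the solution NORMALISED AT `+∞`: `‖u‖ → 1`, `‖u′‖ → |ω|`, and the conserved flux
`Im(ū u′) ≡ ω` (for the radial Teukolsky/Carter equation these are
`Costa2019.tendsto_norm_infinitySolution`, `Costa2019.tendsto_norm_deriv_infinitySolution`,
`Costa2019.radialFlux_eq_of_normalisedInfinity`). Then (`jost_outgoing_remainder`) there is a
unimodular constant `A` with, for every `x > X`,

  `‖u(x) − A e^{iωx}‖ ≤ (B/|ω|) ∫_{(x,∞)} |V|`,  `‖u′(x) − iωA e^{iωx}‖ ≤ B ∫_{(x,∞)} |V|`.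

This is the classical Jost/Volterra estimate at real energy (Hartman Ch. XI §9; DRSR
arXiv:1402.7034 §5.3 "`u_out ∼ e^{iωr*}`"), proved for a GIVEN solution rather than for the
constructed one, so that no separate uniqueness theorem is needed: `exists_outgoing_particular` is
the outgoing particular solution `e(x) = ∫ₓ^∞ ω⁻¹ sin(ω(t − x)) F(t) dt` of `y″ + ω² y = F` (`F = V u`)
by variation of parameters over `e^{±iωx}` (`hasDerivAt_varParams_Ioi`), with
`‖e‖ ≤ |ω|⁻¹ ∫ₓ^∞ ‖F‖`, `‖e′‖ ≤ ∫ₓ^∞ ‖F‖`, `e, e′ → 0`; `w = u − e` solves the FREE equation on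
`(X, ∞)`, so `w = a e^{iωx} + b e^{−iωx}` (`IsSol2.eq_combination`); by `freeWave_energy_flux`,
`ω²‖w‖² + ‖w′‖² = 2ω²(‖a‖² + ‖b‖²)` and `Im(w̄ w′) = ω(‖a‖² − ‖b‖²)`, whose limits along `u` are
`2ω²` and `ω`: `‖a‖² + ‖b‖² = 1 = ‖a‖² − ‖b‖²`, so `b = 0`, `‖a‖ = 1` (no oscillation /
Riemann–Lebesgue argument is needed). Everything is proved; theorems only. NOT here: existence of
such `u` (for Kerr: `Kerr.exists_normalisedInfinitySolution`), complex `ω`, long-range potentials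
(the Coulomb logarithm must already sit in the variable `x`, as for the tortoise coordinate).

## References
* P. Hartman, *Ordinary Differential Equations*, SIAM Classics 38 (2002), Ch. IV §8 (variation of
  constants), Ch. XI §9 (asymptotic integration, `u″ + (1 + q)u = 0` with `∫|q| < ∞`). [Hartman2002]
* M. Dafermos, I. Rodnianski, Y. Shlapentokh-Rothman, arXiv:1402.7034 = Ann. of Math. 183 (2016),
  §5.3 (`u_out`, `u′ − iωu → 0`). [DafermosRodnianskiShlapentokhrothman2014]
-/

noncomputable section

open Set Filter MeasureTheory Topology
open scoped ComplexConjugate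

namespace Literature.Analysis.ODE

/-! ### The free oscillatory pair `e^{iωx}`, `e^{−iωx}` -/

/-- `d/dx e^{iωx} = iω e^{iωx}`. [folklore] -/
theorem hasDerivAt_cexp_I_mul (ω x : ℝ) :
    HasDerivAt (fun y : ℝ ↦ Complex.exp (Complex.I * ω * y))
      (Complex.I * ω * Complex.exp (Complex.I * ω * x)) x := by
  have h := ((hasDerivAt_id x).ofReal_comp.const_mul (Complex.I * ω)).cexp
  simp only [id] at h
  refine h.congr_deriv ?_
  simp; ring

/-- `d/dx e^{−iωx} = −iω e^{−iωx}`. [folklore] -/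
theorem hasDerivAt_cexp_neg_I_mul (ω x : ℝ) :
    HasDerivAt (fun y : ℝ ↦ Complex.exp (-(Complex.I * ω * y)))
      (-(Complex.I * ω) * Complex.exp (-(Complex.I * ω * x))) x := by
  have h := (((hasDerivAt_id x).ofReal_comp.const_mul (Complex.I * ω)).neg).cexp
  simp only [id] at h
  refine h.congr_deriv ?_
  simp; ring

/-- `‖e^{iωx}‖ = 1`. [folklore] -/
theorem norm_cexp_I_mul (ω x : ℝ) : ‖Complex.exp (Complex.I * ω * x)‖ = 1 := by
  rw [Complex.norm_exp]; simp

/-- `‖e^{−iωx}‖ = 1`. [folklore] -/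
theorem norm_cexp_neg_I_mul (ω x : ℝ) : ‖Complex.exp (-(Complex.I * ω * x))‖ = 1 := by
  rw [Complex.norm_exp]; simp

/-- `e^{iωx} e^{−iωx} = 1`. [folklore] -/
theorem cexp_I_mul_mul_cexp_neg (ω x : ℝ) :
    Complex.exp (Complex.I * ω * x) * Complex.exp (-(Complex.I * ω * x)) = 1 := by
  rw [← Complex.exp_add, add_neg_cancel, Complex.exp_zero]

/-- `conj e^{iωx} = e^{−iωx}` (real `ω`, `x`). [folklore] -/
theorem conj_cexp_I_mul (ω x : ℝ) :
    conj (Complex.exp (Complex.I * ω * x)) = Complex.exp (-(Complex.I * ω * x)) := by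
  rw [← Complex.exp_conj]; congr 1; simp [Complex.conj_ofReal]

/-- `conj e^{−iωx} = e^{iωx}` (real `ω`, `x`). [folklore] -/
theorem conj_cexp_neg_I_mul (ω x : ℝ) :
    conj (Complex.exp (-(Complex.I * ω * x))) = Complex.exp (Complex.I * ω * x) := by
  rw [← Complex.exp_conj]; congr 1; simp [Complex.conj_ofReal]

/-- **Energy and flux of a free wave `w = a e^{iωx} + b e^{−iωx}`** (`ω` real): with
`w′ = iω(a e^{iωx} − b e^{−iωx})`, `ω²‖w‖² + ‖w′‖² = 2ω²(‖a‖² + ‖b‖²)` (parallelogram law) and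
`Im(w̄ w′) = ω(‖a‖² − ‖b‖²)` (the cross terms `a b̄ e^{2iωx}`, `ā b e^{−2iωx}` are conjugate).
[folklore] -/
theorem freeWave_energy_flux (ω x : ℝ) (a b : ℂ) :
    ω ^ 2 * ‖a * Complex.exp (Complex.I * ω * x) + b * Complex.exp (-(Complex.I * ω * x))‖ ^ 2 +
        ‖Complex.I * ω * (a * Complex.exp (Complex.I * ω * x) -
          b * Complex.exp (-(Complex.I * ω * x)))‖ ^ 2 =
      2 * ω ^ 2 * (‖a‖ ^ 2 + ‖b‖ ^ 2) ∧
    (conj (a * Complex.exp (Complex.I * ω * x) + b * Complex.exp (-(Complex.I * ω * x))) *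
        (Complex.I * ω * (a * Complex.exp (Complex.I * ω * x) -
          b * Complex.exp (-(Complex.I * ω * x))))).im =
      ω * (‖a‖ ^ 2 - ‖b‖ ^ 2) := by
  set g : ℂ := Complex.exp (Complex.I * ω * x) with hg
  set h : ℂ := Complex.exp (-(Complex.I * ω * x)) with hh
  have hgh : g * h = 1 := cexp_I_mul_mul_cexp_neg ω x
  have hng : ‖g‖ = 1 := norm_cexp_I_mul ω x
  have hnh : ‖h‖ = 1 := norm_cexp_neg_I_mul ω x
  constructor
  · have hpar := parallelogram_law_with_norm ℂ (a * g) (b * h)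
    rw [norm_mul, norm_mul, hng, hnh, mul_one, mul_one] at hpar
    rw [norm_mul, norm_mul, Complex.norm_I, one_mul, Complex.norm_real, Real.norm_eq_abs, mul_pow,
      sq_abs]
    linear_combination ω ^ 2 * hpar
  · set z : ℂ := conj (a * g + b * h) * (Complex.I * ω * (a * g - b * h)) with hz
    have e1 : z - conj z = ((2 * (ω * (‖a‖ ^ 2 - ‖b‖ ^ 2)) : ℝ) : ℂ) * Complex.I := by
      have hcg : conj g = h := conj_cexp_I_mul ω x
      have hch : conj h = g := conj_cexp_neg_I_mul ω x
      simp only [hz, map_mul, map_add, map_sub, Complex.conj_conj, Complex.conj_I,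
        Complex.conj_ofReal, hcg, hch]
      push_cast
      rw [← Complex.mul_conj', ← Complex.mul_conj']
      linear_combination (2 * Complex.I * ω * (a * conj a - b * conj b)) * hgh
    rw [Complex.sub_conj] at e1
    have e2 := Complex.ofReal_injective (mul_right_cancel₀ Complex.I_ne_zero e1)
    linarith

/-! ### Tails of an integrable function -/

/-- `∫_{(x,∞)} F → 0` as `x → +∞`, for `F` integrable on some `(X, ∞)`. [folklore] -/
theorem tendsto_setIntegral_Ioi_atTop {E : Type*} [NormedAddCommGroup E] [NormedSpace ℝ E]
    {F : ℝ → E} {X : ℝ} (hF : IntegrableOn F (Ioi X)) :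
    Tendsto (fun x ↦ ∫ t in Ioi x, F t) atTop (𝓝 0) := by
  have h := tendsto_setIntegral_of_antitone (μ := volume) (f := F) (s := fun z : ℝ ↦ Ioi (max z X))
    (fun _ ↦ measurableSet_Ioi) (fun a b hab ↦ Ioi_subset_Ioi (max_le_max hab le_rfl))
    ⟨X, by rw [max_self]; exact hF⟩
  have he : (⋂ z : ℝ, Ioi (max z X)) = ∅ := eq_empty_of_forall_notMem fun y hy ↦
    lt_irrefl y ((le_max_left y X).trans_lt (mem_iInter.1 hy y))
  rw [he, Measure.restrict_empty, integral_zero_measure] at h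
  refine h.congr' ?_
  filter_upwards [eventually_ge_atTop X] with z hz
  rw [max_eq_left hz]

/-- Size of a weighted tail: if `‖k t‖ = c ‖F t‖` on `(X, ∞)` with `F` integrable there, then
`‖∫_{(x,∞)} k‖ ≤ c ∫_{(x,∞)} ‖F‖` for every `x ≥ X`. [folklore] -/
theorem norm_setIntegral_Ioi_le_of_norm_eq {k F : ℝ → ℂ} {X c : ℝ} (hF : IntegrableOn F (Ioi X))
    (hk : ∀ t, X < t → ‖k t‖ = c * ‖F t‖) {x : ℝ} (hx : X ≤ x) :
    ‖∫ t in Ioi x, k t‖ ≤ c * ∫ t in Ioi x, ‖F t‖ := by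
  have hFx : IntegrableOn (fun t ↦ ‖F t‖) (Ioi x) := (hF.mono_set (Ioi_subset_Ioi hx)).norm
  calc ‖∫ t in Ioi x, k t‖ ≤ ∫ t in Ioi x, c * ‖F t‖ := by
        refine norm_integral_le_of_norm_le (hFx.const_mul c) ?_
        exact (ae_restrict_iff' measurableSet_Ioi).2 (Eventually.of_forall fun t ht ↦
          (hk t (hx.trans_lt ht)).le)
    _ = c * ∫ t in Ioi x, ‖F t‖ := integral_const_mul _ _

/-! ### The outgoing particular solution of `y″ + ω² y = F` -/

/-- **The outgoing particular solution of `y″ + ω²y = F` with data at `+∞`** (`ω ≠ 0` real, `F`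
continuous and integrable on `(X, ∞)`): `e(x) = ∫_{(x,∞)} ω⁻¹ sin(ω(t − x)) F(t) dt`, written by
variation of parameters over the pair `e^{±iωx}` (Wronskian `−2iω`), solves `e″ = −ω² e + F` on
`(X, ∞)` with `‖e(x)‖ ≤ |ω|⁻¹ ∫_{(x,∞)} ‖F‖`, `‖e′(x)‖ ≤ ∫_{(x,∞)} ‖F‖`, and `e, e′ → 0` at `+∞`.
[cite: Hartman2002, Ch. IV §8 (variation of constants)] -/
theorem exists_outgoing_particular {ω : ℝ} (hω : ω ≠ 0) {F : ℝ → ℂ} {X : ℝ}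
    (hFc : ContinuousOn F (Ioi X)) (hFi : IntegrableOn F (Ioi X)) :
    ∃ e e' : ℝ → ℂ,
      (∀ x, X < x → HasDerivAt e (e' x) x ∧ HasDerivAt e' (-((ω : ℂ) ^ 2) * e x + F x) x) ∧
      (∀ x, X < x → ‖e x‖ ≤ |ω|⁻¹ * ∫ t in Ioi x, ‖F t‖) ∧
      (∀ x, X < x → ‖e' x‖ ≤ ∫ t in Ioi x, ‖F t‖) ∧
      Tendsto e atTop (𝓝 0) ∧ Tendsto e' atTop (𝓝 0) := by
  -- the free pair and the Wronskian-normalised weight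
  set g : ℝ → ℂ := fun t ↦ Complex.exp (Complex.I * ω * t) with hg
  set h : ℝ → ℂ := fun t ↦ Complex.exp (-(Complex.I * ω * t)) with hh
  set g' : ℝ → ℂ := fun t ↦ Complex.I * ω * g t with hg'
  set h' : ℝ → ℂ := fun t ↦ -(Complex.I * ω) * h t with hh'
  set W₀ : ℂ := -(2 * Complex.I * ω) with hW₀
  have hW₀ne : W₀ ≠ 0 := by
    rw [hW₀]; exact neg_ne_zero.2 (mul_ne_zero (mul_ne_zero two_ne_zero Complex.I_ne_zero)
      (Complex.ofReal_ne_zero.2 hω))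
  have hW₀norm : ‖W₀‖ = 2 * |ω| := by
    rw [hW₀, norm_neg, norm_mul, norm_mul, Complex.norm_I, mul_one, Complex.norm_ofNat,
      Complex.norm_real, Real.norm_eq_abs]
  have hgh : ∀ t, g t * h t = 1 := fun t ↦ cexp_I_mul_mul_cexp_neg ω t
  have hWt : ∀ t, g t * h' t - g' t * h t = W₀ := fun t ↦ by
    simp only [hg', hh', hW₀]; linear_combination (-(2 * Complex.I * ω)) * hgh t
  set φ : ℝ → ℂ := fun t ↦ F t / W₀ with hφ
  have hφn : ∀ t, ‖φ t‖ = (2 * |ω|)⁻¹ * ‖F t‖ := fun t ↦ by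
    rw [hφ]; simp only; rw [norm_div, hW₀norm]; ring
  -- hypotheses of the variation-of-parameters lemma
  have h1 : ∀ t ∈ Ioi X, HasDerivAt g (g' t) t ∧
      HasDerivAt g' ((fun _ ↦ (0 : ℂ)) t * g' t + (fun _ ↦ -((ω : ℂ) ^ 2)) t * g t) t := fun t _ ↦
    ⟨hasDerivAt_cexp_I_mul ω t, ((hasDerivAt_cexp_I_mul ω t).const_mul (Complex.I * ω)).congr_deriv
      (by simp only [hg', hg]; ring_nf; rw [Complex.I_sq]; ring)⟩
  have h2 : ∀ t ∈ Ioi X, HasDerivAt h (h' t) t ∧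
      HasDerivAt h' ((fun _ ↦ (0 : ℂ)) t * h' t + (fun _ ↦ -((ω : ℂ) ^ 2)) t * h t) t := fun t _ ↦
    ⟨hasDerivAt_cexp_neg_I_mul ω t,
      ((hasDerivAt_cexp_neg_I_mul ω t).const_mul (-(Complex.I * ω))).congr_deriv
      (by simp only [hh', hh]; ring_nf; rw [Complex.I_sq]; ring)⟩
  have hgc : Continuous g := by rw [hg]; fun_prop
  have hhc : Continuous h := by rw [hh]; fun_prop
  have hφc : ContinuousOn φ (Ioi X) := hFc.div_const _
  have hint : ∀ {k : ℝ → ℂ}, Continuous k → (∀ t, ‖k t‖ = 1) →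
      IntegrableOn (fun t ↦ k t * φ t) (Ioi X) := fun {k} hk hk1 ↦ by
    have e : (fun t ↦ k t * φ t) = fun t ↦ (k t / W₀) * F t := by funext t; simp only [hφ]; ring
    exact e ▸ Integrable.bdd_mul hFi (hk.div_const _).aestronglyMeasurable
      (Eventually.of_forall fun t ↦ (by rw [norm_div, hk1] : ‖k t / W₀‖ ≤ 1 / ‖W₀‖))
  have hi1 := hint hgc (norm_cexp_I_mul ω)
  have hi2 := hint hhc (norm_cexp_neg_I_mul ω)
  obtain ⟨e, e', he, he', hsol⟩ := varParams_Ioi_solution h1 h2 hφc hi1 hi2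
  -- tail bounds
  have htail : ∀ {k : ℝ → ℂ}, (∀ t, ‖k t‖ = 1) → ∀ x, X < x →
      ‖∫ t in Ioi x, k t * φ t‖ ≤ (2 * |ω|)⁻¹ * ∫ t in Ioi x, ‖F t‖ := fun {k} hk1 x hx ↦
    norm_setIntegral_Ioi_le_of_norm_eq hFi (fun t _ ↦ by rw [norm_mul, hk1, one_mul, hφn]) hx.le
  have key : ∀ (p q P Q : ℂ) (c T : ℝ), ‖p‖ = c → ‖q‖ = c → ‖P‖ ≤ T → ‖Q‖ ≤ T →
      ‖p * P - q * Q‖ ≤ c * T + c * T := fun p q P Q c T hp hq hP hQ ↦ by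
    have hc : 0 ≤ c := hp ▸ norm_nonneg p
    calc ‖p * P - q * Q‖ ≤ ‖p * P‖ + ‖q * Q‖ := norm_sub_le _ _
      _ = c * ‖P‖ + c * ‖Q‖ := by rw [norm_mul, norm_mul, hp, hq]
      _ ≤ c * T + c * T := by gcongr
  have n1 : ∀ x, ‖g' x‖ = |ω| := fun x ↦ by
    simp only [hg']; rw [norm_mul, norm_mul, norm_cexp_I_mul, Complex.norm_I, Complex.norm_real,
      Real.norm_eq_abs]; ring
  have n2 : ∀ x, ‖h' x‖ = |ω| := fun x ↦ by
    simp only [hh']; rw [norm_mul, norm_neg, norm_mul, norm_cexp_neg_I_mul, Complex.norm_I,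
      Complex.norm_real, Real.norm_eq_abs]; ring
  have hbe : ∀ x, X < x → ‖e x‖ ≤ |ω|⁻¹ * ∫ t in Ioi x, ‖F t‖ := fun x hx ↦ by
    rw [he x]
    refine (key _ _ _ _ 1 _ (norm_cexp_I_mul ω x) (norm_cexp_neg_I_mul ω x)
      (htail (norm_cexp_neg_I_mul ω) x hx) (htail (norm_cexp_I_mul ω) x hx)).trans (le_of_eq ?_)
    field_simp; ring
  have hbe' : ∀ x, X < x → ‖e' x‖ ≤ ∫ t in Ioi x, ‖F t‖ := fun x hx ↦ by
    rw [he' x]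
    refine (key _ _ _ _ |ω| _ (n1 x) (n2 x)
      (htail (norm_cexp_neg_I_mul ω) x hx) (htail (norm_cexp_I_mul ω) x hx)).trans (le_of_eq ?_)
    field_simp; ring
  -- limits
  have hT : Tendsto (fun x ↦ ∫ t in Ioi x, ‖F t‖) atTop (𝓝 0) := tendsto_setIntegral_Ioi_atTop hFi.norm
  refine ⟨e, e', fun x hx ↦ ⟨(hsol x hx).1, ((hsol x hx).2).congr_deriv ?_⟩, hbe, hbe',
    squeeze_zero_norm' (by filter_upwards [eventually_gt_atTop X] with x hx using hbe x hx)
      (by simpa using hT.const_mul |ω|⁻¹),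
    squeeze_zero_norm' (by filter_upwards [eventually_gt_atTop X] with x hx using hbe' x hx) hT⟩
  rw [hWt x]
  simp only [hφ]
  field_simp
  ring

/-! ### The Jost representation of the infinity-normalised solution, with remainder -/

/-- **Outgoing Jost representation with a quantitative remainder (real energy).** Let `ω ≠ 0` be
real, `V` real continuous, `u` a global classical solution of `u″ + (ω² − V)u = 0` with derivative
`u₁`; suppose `V` is integrable and `‖u‖ ≤ B` on `(X, ∞)`, and that `u` has the data of the solution
normalised at `+∞`: `‖u‖ → 1`, `‖u₁‖ → |ω|`, `Im(ū u₁) = ω` on `(X, ∞)`. Then there is `A` with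
`‖A‖ = 1` such that for every `x > X`:
`‖u(x) − A e^{iωx}‖ ≤ (B/|ω|) ∫_{(x,∞)} |V|` and `‖u₁(x) − iωA e^{iωx}‖ ≤ B ∫_{(x,∞)} |V|`
(Hartman Ch. XI §9: solutions of `u″ + (1 + q)u = 0`, `∫^∞ |q| < ∞`, are `A e^{ix} + B e^{−ix} + o(1)`
with the Volterra remainder; here the incoming amplitude is shown to vanish from the normalised end
data via `freeWave_energy_flux`). [cite: Hartman2002, Ch. XI §9] -/
theorem jost_outgoing_remainder {ω : ℝ} (hω : ω ≠ 0) {V : ℝ → ℝ} {u u₁ : ℝ → ℂ} {X B : ℝ}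
    (hu : ∀ x, HasDerivAt u (u₁ x) x ∧ HasDerivAt u₁ (-(((ω ^ 2 - V x : ℝ) : ℂ) * u x)) x)
    (hV : Continuous V) (hVi : IntegrableOn V (Ioi X))
    (hB : ∀ x, X < x → ‖u x‖ ≤ B)
    (hlim : Tendsto (fun x ↦ ‖u x‖) atTop (𝓝 1)) (hlim₁ : Tendsto (fun x ↦ ‖u₁ x‖) atTop (𝓝 |ω|))
    (hflux : ∀ x, X < x → (conj (u x) * u₁ x).im = ω) :
    ∃ A : ℂ, ‖A‖ = 1 ∧ ∀ x, X < x →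
      ‖u x - A * Complex.exp (Complex.I * ω * x)‖ ≤ B / |ω| * ∫ t in Ioi x, |V t| ∧
      ‖u₁ x - Complex.I * ω * A * Complex.exp (Complex.I * ω * x)‖ ≤ B * ∫ t in Ioi x, |V t| := by
  -- the source `F = V u`: continuous, `‖F‖ ≤ B|V|` on `(X, ∞)`, integrable there
  set F : ℝ → ℂ := fun t ↦ ((V t : ℝ) : ℂ) * u t with hF
  have huc : Continuous u := continuous_iff_continuousAt.2 fun t ↦ (hu t).1.continuousAt
  have hFc : Continuous F := (Complex.continuous_ofReal.comp hV).mul huc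
  have hFn : ∀ t, X < t → ‖F t‖ ≤ B * |V t| := fun t ht ↦ by
    simp only [hF]
    rw [norm_mul, Complex.norm_real, Real.norm_eq_abs, mul_comm]
    exact mul_le_mul_of_nonneg_right (hB t ht) (abs_nonneg _)
  have hVn : ∀ x, X ≤ x → IntegrableOn (fun t ↦ B * |V t|) (Ioi x) := fun x hx ↦ by
    have h := (hVi.mono_set (Ioi_subset_Ioi hx)).norm.const_mul B
    show Integrable (fun t ↦ B * |V t|) (volume.restrict (Ioi x))
    simpa only [Real.norm_eq_abs] using h
  have hFi : IntegrableOn F (Ioi X) :=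
    Integrable.mono' (hVn X le_rfl) hFc.aestronglyMeasurable
      ((ae_restrict_iff' measurableSet_Ioi).2 (Eventually.of_forall hFn))
  have hFle : ∀ x, X < x → (∫ t in Ioi x, ‖F t‖) ≤ B * ∫ t in Ioi x, |V t| := fun x hx ↦ by
    rw [← integral_const_mul]
    exact setIntegral_mono_on (hFi.mono_set (Ioi_subset_Ioi hx.le)).norm (hVn x hx.le)
      measurableSet_Ioi fun t ht ↦ hFn t (hx.trans ht)
  -- the outgoing particular solution and the free remainder `w = u − e`
  obtain ⟨e, e', hsol, hbe, hbe', hle, hle'⟩ := exists_outgoing_particular hω hFc.continuousOn hFi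
  set g : ℝ → ℂ := fun t ↦ Complex.exp (Complex.I * ω * t) with hg
  set h : ℝ → ℂ := fun t ↦ Complex.exp (-(Complex.I * ω * t)) with hh
  set g' : ℝ → ℂ := fun t ↦ Complex.I * ω * g t with hg'
  set h' : ℝ → ℂ := fun t ↦ -(Complex.I * ω) * h t with hh'
  have hws : IsSol2 (fun _ ↦ -((ω : ℂ) ^ 2)) (fun x ↦ u x - e x) (fun x ↦ u₁ x - e' x) (Ioi X) :=
    ⟨fun x hx ↦ (hu x).1.sub (hsol x hx).1, fun x hx ↦
      ((hu x).2.sub (hsol x hx).2).congr_deriv (by simp only [hF]; push_cast; ring)⟩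
  have hgs : IsSol2 (fun _ ↦ -((ω : ℂ) ^ 2)) g g' (Ioi X) :=
    ⟨fun x _ ↦ hasDerivAt_cexp_I_mul ω x, fun x _ ↦
      ((hasDerivAt_cexp_I_mul ω x).const_mul (Complex.I * ω)).congr_deriv
        (by simp only [hg]; ring_nf; rw [Complex.I_sq]; ring)⟩
  have hhs : IsSol2 (fun _ ↦ -((ω : ℂ) ^ 2)) h h' (Ioi X) :=
    ⟨fun x _ ↦ hasDerivAt_cexp_neg_I_mul ω x, fun x _ ↦
      ((hasDerivAt_cexp_neg_I_mul ω x).const_mul (-(Complex.I * ω))).congr_deriv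
        (by simp only [hh]; ring_nf; rw [Complex.I_sq]; ring)⟩
  have hgh : ∀ t, g t * h t = 1 := fun t ↦ cexp_I_mul_mul_cexp_neg ω t
  have hX1 : X < X + 1 := lt_add_one X
  have hW : wronskian g g' h h' (X + 1) ≠ 0 := by
    have e1 : wronskian g g' h h' (X + 1) = -(2 * Complex.I * ω) := by
      simp only [wronskian, hg', hh']
      linear_combination (-(2 * Complex.I * ω)) * hgh (X + 1)
    rw [e1]
    exact neg_ne_zero.2 (mul_ne_zero (mul_ne_zero two_ne_zero Complex.I_ne_zero)
      (Complex.ofReal_ne_zero.2 hω))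
  obtain ⟨hrep, hrep'⟩ := hgs.eq_combination continuousOn_const hhs hws hX1 hW
  set a : ℂ := wronskian (fun x ↦ u x - e x) (fun x ↦ u₁ x - e' x) h h' (X + 1) /
    wronskian g g' h h' (X + 1) with ha
  set b : ℂ := wronskian g g' (fun x ↦ u x - e x) (fun x ↦ u₁ x - e' x) (X + 1) /
    wronskian g g' h h' (X + 1) with hb
  have hwx : ∀ x, X < x → u x - e x = a * g x + b * h x := fun x hx ↦ hrep hx
  have hw'x : ∀ x, X < x → u₁ x - e' x = Complex.I * ω * (a * g x - b * h x) := fun x hx ↦ by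
    have h1 : u₁ x - e' x = a * g' x + b * h' x := hrep' hx
    rw [h1]; simp only [hg', hh']; ring
  -- energy and flux of `w` are constant …
  have hEF := fun x ↦ freeWave_energy_flux ω x a b
  have hE : ∀ x, X < x → ω ^ 2 * ‖u x - e x‖ ^ 2 + ‖u₁ x - e' x‖ ^ 2 = 2 * ω ^ 2 * (‖a‖ ^ 2 + ‖b‖ ^ 2) :=
    fun x hx ↦ by rw [hwx x hx, hw'x x hx]; exact (hEF x).1
  have hFl : ∀ x, X < x → (conj (u x - e x) * (u₁ x - e' x)).im = ω * (‖a‖ ^ 2 - ‖b‖ ^ 2) :=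
    fun x hx ↦ by rw [hwx x hx, hw'x x hx]; exact (hEF x).2
  -- … and tend to `2ω²` resp. `ω`
  have hwlim : Tendsto (fun x ↦ ‖u x - e x‖) atTop (𝓝 1) := by
    have h0 : Tendsto (fun x ↦ ‖e x‖) atTop (𝓝 0) := by simpa using hle.norm
    have hlo : Tendsto (fun x ↦ ‖u x‖ - ‖e x‖) atTop (𝓝 1) := by simpa using hlim.sub h0
    have hhi : Tendsto (fun x ↦ ‖u x‖ + ‖e x‖) atTop (𝓝 1) := by simpa using hlim.add h0
    exact tendsto_of_tendsto_of_tendsto_of_le_of_le hlo hhi (fun x ↦ norm_sub_norm_le _ _)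
      fun x ↦ norm_sub_le _ _
  have hw'lim : Tendsto (fun x ↦ ‖u₁ x - e' x‖) atTop (𝓝 |ω|) := by
    have h0 : Tendsto (fun x ↦ ‖e' x‖) atTop (𝓝 0) := by simpa using hle'.norm
    have hlo : Tendsto (fun x ↦ ‖u₁ x‖ - ‖e' x‖) atTop (𝓝 |ω|) := by simpa using hlim₁.sub h0
    have hhi : Tendsto (fun x ↦ ‖u₁ x‖ + ‖e' x‖) atTop (𝓝 |ω|) := by simpa using hlim₁.add h0
    exact tendsto_of_tendsto_of_tendsto_of_le_of_le hlo hhi (fun x ↦ norm_sub_norm_le _ _)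
      fun x ↦ norm_sub_le _ _
  have hElim : Tendsto (fun x ↦ ω ^ 2 * ‖u x - e x‖ ^ 2 + ‖u₁ x - e' x‖ ^ 2) atTop (𝓝 (2 * ω ^ 2)) := by
    have h := ((hwlim.pow 2).const_mul (ω ^ 2)).add (hw'lim.pow 2)
    rw [one_pow, mul_one, sq_abs, ← two_mul] at h
    exact h
  have hFlim : Tendsto (fun x ↦ (conj (u x - e x) * (u₁ x - e' x)).im) atTop (𝓝 ω) := by
    set T : ℝ → ℂ := fun x ↦ conj (u x) * e' x + conj (e x) * (u₁ x - e' x) with hT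
    have hub : IsBoundedUnder (· ≤ ·) atTop (norm ∘ fun x ↦ conj (u x)) := by
      have e1 : (norm ∘ fun x ↦ conj (u x)) = fun x ↦ ‖u x‖ := funext fun x ↦ Complex.norm_conj _
      rw [e1]
      exact hlim.isBoundedUnder_le
    have h1 : Tendsto (fun x ↦ conj (u x) * e' x) atTop (𝓝 0) :=
      isBoundedUnder_le_mul_tendsto_zero hub hle'
    have hce : Tendsto (fun x ↦ conj (e x)) atTop (𝓝 0) := by
      have h := (Complex.continuous_conj.tendsto 0).comp hle
      rwa [map_zero] at h
    have h2 : Tendsto (fun x ↦ conj (e x) * (u₁ x - e' x)) atTop (𝓝 0) :=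
      hce.zero_mul_isBoundedUnder_le hw'lim.isBoundedUnder_le
    have hTl : Tendsto T atTop (𝓝 0) := by simpa using h1.add h2
    have hTim : Tendsto (fun x ↦ ω - (T x).im) atTop (𝓝 ω) := by
      simpa using tendsto_const_nhds.sub ((Complex.continuous_im.tendsto 0).comp hTl)
    refine hTim.congr' ?_
    filter_upwards [eventually_gt_atTop X] with x hx
    have e2 : conj (u x - e x) * (u₁ x - e' x) = conj (u x) * u₁ x - T x := by
      simp only [hT, map_sub]; ring
    rw [e2, Complex.sub_im, hflux x hx]
  -- hence `‖a‖² + ‖b‖² = 1` and `‖a‖² − ‖b‖² = 1`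
  have hsum : ‖a‖ ^ 2 + ‖b‖ ^ 2 = 1 := by
    have hc : Tendsto (fun _ : ℝ ↦ 2 * ω ^ 2 * (‖a‖ ^ 2 + ‖b‖ ^ 2)) atTop (𝓝 (2 * ω ^ 2)) := by
      refine hElim.congr' ?_
      filter_upwards [eventually_gt_atTop X] with x hx using hE x hx
    have := tendsto_nhds_unique tendsto_const_nhds hc
    have hω2 : 0 < ω ^ 2 := by positivity
    nlinarith
  have hdiff : ‖a‖ ^ 2 - ‖b‖ ^ 2 = 1 := by
    have hc : Tendsto (fun _ : ℝ ↦ ω * (‖a‖ ^ 2 - ‖b‖ ^ 2)) atTop (𝓝 ω) := by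
      refine hFlim.congr' ?_
      filter_upwards [eventually_gt_atTop X] with x hx using hFl x hx
    have := tendsto_nhds_unique tendsto_const_nhds hc
    have : ω * (‖a‖ ^ 2 - ‖b‖ ^ 2 - 1) = 0 := by linarith
    exact sub_eq_zero.1 ((mul_eq_zero.1 this).resolve_left hω)
  have hb0 : b = 0 := norm_eq_zero.1 (pow_eq_zero_iff two_ne_zero |>.1 (by linarith))
  have ha1 : ‖a‖ = 1 := (pow_eq_one_iff_of_nonneg (norm_nonneg a) two_ne_zero).1 (by linarith)
  -- the representation `u = a e^{iωx} + e`, `u₁ = iω a e^{iωx} + e′`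
  refine ⟨a, ha1, fun x hx ↦ ⟨?_, ?_⟩⟩
  · have e1 : u x - a * Complex.exp (Complex.I * ω * x) = e x := by
      have := hwx x hx; rw [hb0, zero_mul, add_zero] at this
      linear_combination this
    rw [e1]
    calc ‖e x‖ ≤ |ω|⁻¹ * ∫ t in Ioi x, ‖F t‖ := hbe x hx
      _ ≤ |ω|⁻¹ * (B * ∫ t in Ioi x, |V t|) :=
          mul_le_mul_of_nonneg_left (hFle x hx) (inv_nonneg.2 (abs_nonneg ω))
      _ = B / |ω| * ∫ t in Ioi x, |V t| := by ring
  · have e1 : u₁ x - Complex.I * ω * a * Complex.exp (Complex.I * ω * x) = e' x := by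
      have := hw'x x hx; rw [hb0, zero_mul, sub_zero] at this
      linear_combination this
    rw [e1]
    exact (hbe' x hx).trans (hFle x hx)

end Literature.Analysis.ODE

end
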